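import Summits.QuantumFields.YangMills.Theorems.SwapVirialDeficitSectorLaplaceTipPXMain
import Summits.QuantumFields.YangMills.Theorems.SwapVirialDeficitSectorLaplaceTipPXPointwise
import Summits.QuantumFields.YangMills.Theorems.SwapVirialDeficitSectorLaplaceTipWindowConstants
import Summits.QuantumFields.YangMills.Theorems.SwapVirialDeficitSectorLaplaceTipZFactor
import Summits.QuantumFields.YangMills.Theorems.SwapVirialDeficitSectorLaplaceEndGaussRefWeightMeasurable
import Summits.QuantumFields.YangMills.Theorems.SwapVirialDeficitSectorLaplaceEndGaussTails
import HarnessLib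

/-!
# Route `SwapVirialDeficit` (YangMills): THE PX REGION SOCKET OF THE TIP CORE (hCore, aligned frame (B8)) — `leaderLayer_PX`
# (cell ym-idea-1, skeleton ➎, `stub_core_tip`, the core; free-hands support of ⟨stmt-QuantumFields-24197⟩ `SwapVirialDeficit.SwapGluedStiffness`)

★★★ `leaderLayer_PX` — LEAD g100's region socket (B9) for `S₂ = PX = {|y|² ≤ |x|², (1+δt²)⁻¹ < |x|²}` (the `h₂` of ✓`leaderLayer_aligned`), with the
constants of ✓`TipWindowConstants` (`κf⋆, sT⋆`, `DR⋆ = 25·10¹⁶`, exponent 18, `QT⋆`, exponent 88):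
`∫⁻_{xy ∈ PX} ∫⁻_z w(x)w(y)w(z)·∫⁻_F e^{−bF̂}piWeight ≤ ofReal(10¹⁹·L²⁴·(2π∕b)^{7∕2}·G_b)·∫⁻_p Profile·w₀∕√det A₀(gnoBase p) + ofReal(e^{70L⁸⁸ − b∕(QT⋆L⁸⁸)})`.
Assembly: ✓`tipPX_pointwise` (per point), the z-Gaussian (w ≤ 1, LEAD's ✓`lintegral_exp_neg_mul_normSq3`), ✓`lintegral_PX_main_le` (w2, the leader integral against
the profile with `D = (√det)⁻¹`, ✓`measurable_D_ref`), the tails `e^{−bκ_R}I_W·π⁶` and `T_far·π⁶` (✓`tipRate_facts`, ✓`integral_piWeight_gnoFolBlocks_le_exp`,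
✓`lintegral_piWeight_le_exp`, ✓`lintegral_gnomonicWeight`), and the `b`-bookkeeping `(π·28800L⁶∕b)^{3∕2}·(14400·3600L¹²∕b²) ≤ 14400³·3600·L²⁴·(2π∕b)^{7∕2}∕(4π²)`.

HONEST LABEL: the PX region socket is PROVED here; PY (swap twin), ORIG (LEAD g100), the merge instance, hence `hLLm` ∕ hCore ∕ `stub_core_tip` ∕ ⟨24197⟩ ∕ ⟨24194⟩
remain OPEN; own crux ⟨22884⟩ `LargeFieldMassRefinementTail` OPEN (blocked-on ⟨19935⟩); the Yang–Mills mass gap is NOT proved; no summit is proved by a line.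
THEOREMS ONLY (0 `def`, 0 `sorry`, no instance), standard axioms.  Width seat ym-line-sfw-p2-w2 g61 (cell ym-idea-1, free hands), `--supports stmt-QuantumFields-24197`.
References: [cite: Luscher1983, §2]; [folklore].
-/

set_option autoImplicit false
set_option synthInstance.maxSize 1024

noncomputable section

open MeasureTheory Quaternion Set Module
open scoped Quaternion BigOperators ENNReal InnerProductSpace
open Literature.MathematicalPhysics.QuantumLattice
open Literature.MathematicalPhysics.QuantumFieldTheory hiding SU2

namespace Summit.QuantumFields.YangMills.Theorems.SwapVirialDeficit.SectorLaplace

open Summit.QuantumFields.YangMills.Theorems.FemtoTransferGap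
open Summit.QuantumFields.YangMills.Theorems.FemtoTransferGap.TT
open Summit.QuantumFields.YangMills.Theorems.VirialFluxGap.RingDeficit
open Summit.QuantumFields.YangMills.Theorems.SwapVirialDeficit.SwapRing
open Summit.QuantumFields.YangMills.Theorems.SwapVirialDeficit.BlowUpRing
open Summit.QuantumFields.YangMills.Theorems.SwapVirialDeficit.Gnomonic (piWeight piWeight_pos piWeight_le_one normSq3 normSq3_nonneg gnomonicWeight
  gnomonicWeight_pos gnomonicWeight_le_one lintegral_gnomonicWeight)

variable {L : ℕ} [NeZero L]

/-! ## §1 Two bookkeeping inequalities -/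

/-- The `b`-bookkeeping of the PX main term: `e^{3∕2}·(π·28800L⁶∕b)^{3∕2}·((3π+48)π²·14400·3600·L¹²∕b²) ≤ 10¹⁹·L²⁴·(2π∕b)^{7∕2}`. [folklore] -/
theorem px_main_const_le {Lr b : ℝ} (hL : 1 ≤ Lr) (hb : 0 < b) :
    Real.exp (3 / 2) * (Real.pi / (b / (28800 * Lr ^ 6))) ^ ((3 : ℝ) / 2) *
        ((3 * Real.pi + 48) * Real.pi ^ 2 / (b / (14400 * Lr ^ 6) * (b / (3600 * Lr ^ 6)))) ≤
      (10 : ℝ) ^ 19 * Lr ^ 24 * (2 * Real.pi / b) ^ ((7 : ℝ) / 2) := by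
  have hL0 : 0 < Lr := by linarith
  have hπ := Real.pi_gt_three
  have hπ4 := Real.pi_lt_four
  have hq : 0 < 2 * Real.pi / b := by positivity
  -- `(π·28800L⁶/b)^{3/2} = (2π/b)^{3/2}·(14400L⁶)^{3/2} ≤ (2π/b)^{3/2}·(14400L⁶)²`
  have e1 : Real.pi / (b / (28800 * Lr ^ 6)) = (2 * Real.pi / b) * (14400 * Lr ^ 6) := by field_simp; ring
  have hY1 : (1 : ℝ) ≤ 14400 * Lr ^ 6 := by nlinarith [one_le_pow₀ (M₀ := ℝ) hL (n := 6)]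
  have h32 : (14400 * Lr ^ 6) ^ ((3 : ℝ) / 2) ≤ (14400 * Lr ^ 6) ^ 2 := by
    rw [← Real.rpow_natCast _ 2]
    exact Real.rpow_le_rpow_of_exponent_le hY1 (by norm_num)
  have hA : (Real.pi / (b / (28800 * Lr ^ 6))) ^ ((3 : ℝ) / 2) ≤ (2 * Real.pi / b) ^ ((3 : ℝ) / 2) * (14400 * Lr ^ 6) ^ 2 := by
    rw [e1, Real.mul_rpow hq.le (by positivity)]
    exact mul_le_mul_of_nonneg_left h32 (by positivity)
  -- `1/b² = (2π/b)²/(4π²)` and `(2π/b)^{3/2}·(2π/b)² = (2π/b)^{7/2}`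
  have e2 : (3 * Real.pi + 48) * Real.pi ^ 2 / (b / (14400 * Lr ^ 6) * (b / (3600 * Lr ^ 6))) =
      (3 * Real.pi + 48) * 14400 * 3600 / 4 * Lr ^ 12 * (2 * Real.pi / b) ^ 2 := by
    field_simp; ring
  have e72 : (2 * Real.pi / b) ^ ((3 : ℝ) / 2) * (2 * Real.pi / b) ^ 2 = (2 * Real.pi / b) ^ ((7 : ℝ) / 2) := by
    rw [← Real.rpow_natCast _ 2, ← Real.rpow_add hq]; norm_num
  have he : Real.exp (3 / 2) ≤ 8 := by
    have h1 := Real.exp_one_lt_d9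
    have h2 : Real.exp (3 / 2) ≤ Real.exp 2 := Real.exp_le_exp.2 (by norm_num)
    have h3 : Real.exp 2 = Real.exp 1 ^ 2 := by rw [← Real.exp_nat_mul]; norm_num
    nlinarith [Real.exp_pos 1]
  calc Real.exp (3 / 2) * (Real.pi / (b / (28800 * Lr ^ 6))) ^ ((3 : ℝ) / 2) * ((3 * Real.pi + 48) * Real.pi ^ 2 / (b / (14400 * Lr ^ 6) * (b / (3600 * Lr ^ 6))))
      ≤ 8 * ((2 * Real.pi / b) ^ ((3 : ℝ) / 2) * (14400 * Lr ^ 6) ^ 2) * ((3 * Real.pi + 48) * 14400 * 3600 / 4 * Lr ^ 12 * (2 * Real.pi / b) ^ 2) := by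
        rw [e2]; gcongr
    _ = (8 * 14400 ^ 2 * ((3 * Real.pi + 48) * 14400 * 3600 / 4)) * Lr ^ 24 * ((2 * Real.pi / b) ^ ((3 : ℝ) / 2) * (2 * Real.pi / b) ^ 2) := by ring
    _ ≤ (10 : ℝ) ^ 19 * Lr ^ 24 * (2 * Real.pi / b) ^ ((7 : ℝ) / 2) := by
        rw [e72]
        refine mul_le_mul_of_nonneg_right (mul_le_mul_of_nonneg_right ?_ (by positivity)) (by positivity)
        nlinarith

/-- The tail bookkeeping: `π⁶·(e^{60L⁴} + e^{60L⁴})·e^{−b∕(Q·L⁸⁸)} ≤ e^{70·L⁸⁸ − b∕(Q·L⁸⁸)}`. [folklore] -/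
theorem px_tail_const_le {Lr b Q : ℝ} (hL : 1 ≤ Lr) :
    Real.pi ^ 6 * (Real.exp (60 * Lr ^ 4) + Real.exp (60 * Lr ^ 4)) * Real.exp (-(b / (Q * Lr ^ 88))) ≤ Real.exp (70 * Lr ^ 88 - b / (Q * Lr ^ 88)) := by
  have hπ4 := Real.pi_lt_four
  have hπ0 := Real.pi_pos
  have hL4 : Lr ^ 4 ≤ Lr ^ 88 := pow_le_pow_right₀ hL (by norm_num)
  have hL88 : (1 : ℝ) ≤ Lr ^ 88 := one_le_pow₀ hL
  have h1 : Real.pi ^ 6 * 2 ≤ Real.exp 10 := by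
    have he : (2.7 : ℝ) ≤ Real.exp 1 := by linarith [Real.exp_one_gt_d9]
    have h10 : (2.7 : ℝ) ^ 10 ≤ Real.exp 1 ^ 10 := pow_le_pow_left₀ (by norm_num) he 10
    have hexp10 : Real.exp 1 ^ 10 = Real.exp 10 := by rw [← Real.exp_nat_mul]; norm_num
    rw [← hexp10]
    have hp6 : Real.pi ^ 6 ≤ 4 ^ 6 := pow_le_pow_left₀ hπ0.le hπ4.le 6
    nlinarith
  rw [← two_mul, sub_eq_add_neg, Real.exp_add]
  refine mul_le_mul_of_nonneg_right ?_ (Real.exp_pos _).le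
  calc Real.pi ^ 6 * (2 * Real.exp (60 * Lr ^ 4)) = (Real.pi ^ 6 * 2) * Real.exp (60 * Lr ^ 4) := by ring
    _ ≤ Real.exp 10 * Real.exp (60 * Lr ^ 4) := mul_le_mul_of_nonneg_right h1 (Real.exp_pos _).le
    _ = Real.exp (10 + 60 * Lr ^ 4) := by rw [Real.exp_add]
    _ ≤ Real.exp (70 * Lr ^ 88) := Real.exp_le_exp.2 (by nlinarith)

/-! ## §2 The PX region socket -/

set_option maxHeartbeats 3200000 in
/-- ★★★ **THE PX REGION SOCKET OF THE TIP CORE** (aligned frame; see the file header). [cite: Luscher1983, §2] -/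
theorem leaderLayer_PX :
    ∃ Φ : ℝ, 0 < Φ ∧ ∃ cΦ : ℕ, ∃ CT : ℝ, ∃ pT : ℕ, ∃ QT : ℝ, 0 < QT ∧ ∃ K₁ : ℝ, 0 < K₁ ∧ ∃ k₁ : ℕ, ∃ DR : ℝ, 1 ≤ DR ∧ ∃ dR : ℕ,
      ∀ (L : ℕ) [NeZero L] (b : ℝ), K₁ * (L : ℝ) ^ k₁ ≤ b → ∀ ε : GnoSign L, GoodSign ε → ∀ δt : ℝ, DR * (L : ℝ) ^ dR ≤ δt →
        ∀ (A0 : GnoCoord L → GnoFol L →ₗ[ℝ] GnoFol L), (∀ η, (A0 η).IsSymmetric) →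
          (∀ η (y : GnoFol L), ⟪A0 η y, y⟫_ℝ = iteratedFDeriv ℝ 2 (fun y' : GnoFol L => gnoDeficit z₀ (fun _ => 1) ((1 : ℝ) : ℍ) ε (η + gnoFolEmb y')) 0 (fun _ => y)) →
          (∀ η (y : GnoFol L), ⟪A0 η y, y⟫_ℝ = iteratedDeriv 2 (fun s : ℝ => gnoDeficit (fun _ => false) (fun _ => 1) ((1 : ℝ) : ℍ) ε (η + s • gnoFolEmb y)) 0) →
          (∀ η (y : GnoFol L), ⟪A0 η y, y⟫_ℝ = iteratedFDeriv ℝ 2 (gnoDeficit z₀ (fun _ => 1) ((1 : ℝ) : ℍ) ε) η (fun _ => gnoFolEmb y)) →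
          (Measurable fun q : GnoCoord L × GnoFol L => ⟪A0 q.1 q.2, q.2⟫_ℝ) →
          ∫⁻ xy in {xy : (Fin 3 → ℝ) × (Fin 3 → ℝ) | normSq3 xy.2 ≤ normSq3 xy.1 ∧ (1 + δt ^ 2)⁻¹ < normSq3 xy.1},
              ∫⁻ z : Fin 3 → ℝ, ENNReal.ofReal (gnomonicWeight xy.1 * gnomonicWeight xy.2 * gnomonicWeight z) *
              ∫⁻ F : Fol L → Fin 3 → ℝ,
                ENNReal.ofReal (Real.exp (-(b * gnoDeficit (fun _ => false) (fun _ => 1) (hubAt δt 1) ε ((xy, (z, F)) : GnoCoord L))) * piWeight F) ≤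
            ENNReal.ofReal (Φ * (L : ℝ) ^ cΦ * (2 * Real.pi / b) ^ ((7 : ℝ) / 2) *
                (2 * Real.pi / ((1 - 1 / (2 * (finrank ℝ (GnoFol L) : ℝ))) * b)) ^ ((finrank ℝ (GnoFol L) : ℝ) / 2)) *
              (∫⁻ p : ℝ × ℝ, ENNReal.ofReal ((1 + δt ^ 2) ^ 2 / (1 + (p.1 ^ 2 / (1 + p.1 ^ 2) + p.2 ^ 2 / (1 + p.2 ^ 2)) * (1 + δt ^ 2)) *
                ((1 + p.1 ^ 2)⁻¹ * (1 + p.2 ^ 2)⁻¹ / Real.sqrt (LinearMap.det (A0 (gnoBase p.1 p.2)))))) +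
            ENNReal.ofReal (Real.exp (CT * (L : ℝ) ^ pT - b / (QT * (L : ℝ) ^ pT))) := by
  refine ⟨(10 : ℝ) ^ 19, by positivity, 24, 70, 88, (1800 * 625 * (2304 * 12 * 3219264 * 36) ^ 4 * 300 * 3600 : ℝ), by positivity, 1, one_pos, 0,
    (25 * 10 ^ 16 : ℝ), by norm_num, 18, ?_⟩
  intro L _ b hb ε hε δt hδt A0 hA0s hA0yy hA0ray hA0amb hAm
  -- sizes and constants
  obtain ⟨hL1, hN1, hN6, hμlo, hμ0, hμ1⟩ := tipSizes_facts (L := L)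
  have hL0 : (0 : ℝ) < (L : ℝ) := by linarith
  obtain ⟨hκ0, hκT1, hκwin, hθhalf, hθwin, -⟩ := tipKf_facts (L := L)
  obtain ⟨hsT0, hs2⟩ := tipST_facts (L := L)
  obtain ⟨hQT0, hrate_far, hrate_R⟩ := tipRate_facts (L := L)
  obtain ⟨hδt1, hwinδ, -⟩ := tipDelta_facts (L := L) hδt
  have hb1 : 1 ≤ b := by simpa using hb
  have hb0 : 0 < b := by linarith
  set κf : ℝ := ((1800 * 625 * (2304 * 12 * 3219264 * 36) ^ 4 : ℝ) * (L : ℝ) ^ 78)⁻¹ with hκf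
  set sT : ℝ := ((13824 * 10 ^ 6 : ℝ) * (L : ℝ) ^ 14)⁻¹ with hsT
  set QT : ℝ := (1800 * 625 * (2304 * 12 * 3219264 * 36) ^ 4 * 300 * 3600 : ℝ) with hQT
  set μ : ℝ := (2304 * (L : ℝ) ^ 6 * (Fintype.card (Fol L) : ℝ))⁻¹ with hμ
  set d : ℝ := (finrank ℝ (GnoFol L) : ℝ) with hd
  set σ : ℝ := (1 + δt ^ 2)⁻¹ with hσ
  have hσ0 : 0 < σ := by positivity
  set β₁ : ℝ := b / (14400 * (L : ℝ) ^ 6) with hβ₁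
  set β₃ : ℝ := b / (3600 * (L : ℝ) ^ 6) with hβ₃
  set κz : ℝ := b / (28800 * (L : ℝ) ^ 6) with hκz
  have hβ₁0 : 0 < β₁ := by positivity
  have hβ₃0 : 0 < β₃ := by positivity
  have hκz0 : 0 < κz := by positivity
  set Gb : ℝ := (2 * Real.pi / ((1 - 1 / (2 * d)) * b)) ^ (d / 2) with hGb
  have hd9 : (9 : ℝ) ≤ d := nine_le_finrank_gnoFol (L := L)
  have hd1 : 0 < 1 - 1 / (2 * d) := by rw [sub_pos, div_lt_one (by positivity)]; linarith
  have hGb0 : 0 ≤ Gb := by rw [hGb]; exact Real.rpow_nonneg (div_nonneg (by positivity) (mul_nonneg hd1.le hb0.le)) _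
  set κR : ℝ := μ * (3 * (μ / 2) / (2 * d * (2484000 * (L : ℝ) ^ 4))) ^ 2 / 4 with hκR
  set IW : ℝ := ∫ w : GnoFol L, piWeight (gnoFolBlocks w) with hIW
  obtain ⟨hWm, hWpos, hWle, hWint⟩ := folWeight_facts (L := L)
  have hIW0 : 0 ≤ IW := by rw [hIW]; exact integral_nonneg fun w => (hWpos w).le
  have hIWle : IW ≤ Real.exp (60 * (L : ℝ) ^ 4) := integral_piWeight_gnoFolBlocks_le_exp (L := L)
  set rate : ℝ := min (sT ^ 2) (κf / (300 * (L : ℝ) ^ 4)) / (3600 * (L : ℝ) ^ 6) with hrate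
  set Tfar : ℝ≥0∞ := ENNReal.ofReal (Real.exp (-(b * rate))) * ∫⁻ F : Fol L → Fin 3 → ℝ, ENNReal.ofReal (piWeight F) with hTfar
  set Ktail : ℝ := Real.exp (-(b * κR)) * IW with hKtail
  have hKtail0 : 0 ≤ Ktail := by positivity
  -- the reference factor
  set Dm : ℝ × ℝ → ℝ≥0∞ := fun p => ENNReal.ofReal ((Real.sqrt (LinearMap.det (A0 (gnoBase (L := L) p.1 p.2))))⁻¹) with hDm
  have hDmm : Measurable Dm := measurable_D_ref hA0s hAm
  -- the pieces of the majorant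
  have hmeasN : Measurable (normSq3 : (Fin 3 → ℝ) → ℝ) := continuous_normSq3.measurable
  have hw : Measurable (gnomonicWeight : (Fin 3 → ℝ) → ℝ) := by
    unfold gnomonicWeight; exact ((measurable_const.add hmeasN).inv).pow_const 2
  set Ex : (Fin 3 → ℝ) → ℝ≥0∞ := fun x => ENNReal.ofReal (gnomonicWeight x * Real.exp (-(β₁ * (2 * σ * (x 1 ^ 2 + x 2 ^ 2) / (1 + normSq3 x))))) with hEx
  set Fy : (Fin 3 → ℝ) → (Fin 3 → ℝ) → ℝ≥0∞ := fun x y =>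
    ENNReal.ofReal (gnomonicWeight y * Real.exp (-(β₃ * (4 * ((x 1 * y 2 - x 2 * y 1) ^ 2 + (x 2 * y 0 - x 0 * y 2) ^ 2 + (x 0 * y 1 - x 1 * y 0) ^ 2) /
        ((1 + normSq3 x) * (1 + normSq3 y)))))) *
      Dm (Real.sqrt (normSq3 x), (Real.sqrt (normSq3 x))⁻¹ * (x 0 * y 0 + x 1 * y 1 + x 2 * y 2)) with hFy
  set Ez : (Fin 3 → ℝ) → ℝ≥0∞ := fun z => ENNReal.ofReal (gnomonicWeight z * Real.exp (-(κz * normSq3 z))) with hEz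
  have hEzm : Measurable Ez := by
    rw [hEz]; exact Measurable.ennreal_ofReal (hw.mul (Real.measurable_exp.comp ((hmeasN.const_mul κz).neg)))
  -- the z-factor
  have hZ : ∫⁻ z, Ez z ≤ ENNReal.ofReal ((Real.pi / κz) ^ ((3 : ℝ) / 2)) := by
    rw [← lintegral_exp_neg_mul_normSq3 hκz0]
    refine lintegral_mono fun z => ?_
    rw [hEz]
    exact ENNReal.ofReal_le_ofReal (mul_le_of_le_one_left (Real.exp_pos _).le (gnomonicWeight_le_one z))
  have hWz : ∫⁻ z : Fin 3 → ℝ, ENNReal.ofReal (gnomonicWeight z) = ENNReal.ofReal (Real.pi ^ 2) := lintegral_gnomonicWeight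
  -- POINTWISE: on PX, `www·J ≤ Ex·Fy·(cA·Ez) + w(x)w(y)·w(z)·(Ktail + Tfar)`
  set S : Set ((Fin 3 → ℝ) × (Fin 3 → ℝ)) := {xy | normSq3 xy.2 ≤ normSq3 xy.1 ∧ σ < normSq3 xy.1} with hSdef
  have hS : MeasurableSet S := by
    rw [hSdef]
    exact (measurableSet_le (hmeasN.comp measurable_snd) (hmeasN.comp measurable_fst)).inter (measurableSet_lt measurable_const (hmeasN.comp measurable_fst))
  have hpt : ∀ xy : (Fin 3 → ℝ) × (Fin 3 → ℝ), xy ∈ S → ∀ z : Fin 3 → ℝ,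
      ENNReal.ofReal (gnomonicWeight xy.1 * gnomonicWeight xy.2 * gnomonicWeight z) *
          ∫⁻ F : Fol L → Fin 3 → ℝ, ENNReal.ofReal (Real.exp (-(b * gnoDeficit (fun _ => false) (fun _ => 1) (hubAt δt 1) ε ((xy, (z, F)) : GnoCoord L))) * piWeight F) ≤
        Ex xy.1 * Fy xy.1 xy.2 * (ENNReal.ofReal (Real.exp (3 / 2) * Gb) * Ez z) +
          ENNReal.ofReal (gnomonicWeight xy.1 * gnomonicWeight xy.2) * (ENNReal.ofReal Ktail + Tfar) * ENNReal.ofReal (gnomonicWeight z) := by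
    intro xy hxy z
    obtain ⟨x, y⟩ := xy
    obtain ⟨hyx, hsx⟩ := hxy
    simp only at hyx hsx ⊢
    have hxpos : 0 < (x 0) ^ 2 + (x 1) ^ 2 + (x 2) ^ 2 := by rw [← normSq3_eq_three']; exact hσ0.trans hsx
    have hyx' : (y 0) ^ 2 + (y 1) ^ 2 + (y 2) ^ 2 ≤ (x 0) ^ 2 + (x 1) ^ 2 + (x 2) ^ 2 := by rw [← normSq3_eq_three', ← normSq3_eq_three']; exact hyx
    have hP := tipPX_pointwise (L := L) hε hδt1 hwinδ hA0s hA0yy hA0ray hA0amb x y z hxpos hyx' hsT0 hκ0 hs2 hκT1 hκwin hθhalf hθwin hb0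
    -- rewrite the pointwise bound in the letters `Ex, Fy, Ez, Dm`
    have hNx : (x 0) ^ 2 + (x 1) ^ 2 + (x 2) ^ 2 = normSq3 x := (normSq3_eq_three' x).symm
    have hNy : (y 0) ^ 2 + (y 1) ^ 2 + (y 2) ^ 2 = normSq3 y := (normSq3_eq_three' y).symm
    have hNz : (z 0) ^ 2 + (z 1) ^ 2 + (z 2) ^ 2 = normSq3 z := (normSq3_eq_three' z).symm
    rw [hNx, hNy, hNz] at hP
    have hw3 : 0 ≤ gnomonicWeight x * gnomonicWeight y * gnomonicWeight z :=
      mul_nonneg (mul_nonneg (gnomonicWeight_pos x).le (gnomonicWeight_pos y).le) (gnomonicWeight_pos z).le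
    refine (mul_le_mul' le_rfl hP).trans ?_
    rw [mul_add]
    -- names for the real factors
    set e1 : ℝ := Real.exp (-(β₁ * (2 * σ * ((x 1) ^ 2 + (x 2) ^ 2) / (1 + normSq3 x)))) with he1
    set e3 : ℝ := Real.exp (-(β₃ * (4 * ((x 1 * y 2 - x 2 * y 1) ^ 2 + (x 2 * y 0 - x 0 * y 2) ^ 2 + (x 0 * y 1 - x 1 * y 0) ^ 2) / ((1 + normSq3 x) * (1 + normSq3 y))))) with he3
    set ez : ℝ := Real.exp (-(κz * normSq3 z)) with hez
    set Dr : ℝ := (Real.sqrt (LinearMap.det (A0 (gnoBase (Real.sqrt (normSq3 x)) ((Real.sqrt (normSq3 x))⁻¹ * (x 0 * y 0 + x 1 * y 1 + x 2 * y 2))))))⁻¹ with hDr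
    have hDr0 : 0 ≤ Dr := by rw [hDr]; exact inv_nonneg.2 (Real.sqrt_nonneg _)
    have hwx := (gnomonicWeight_pos x).le
    have hwy := (gnomonicWeight_pos y).le
    have hwz := (gnomonicWeight_pos z).le
    have he10 : 0 ≤ e1 := (Real.exp_pos _).le
    have he30 : 0 ≤ e3 := (Real.exp_pos _).le
    have hez0 : 0 ≤ ez := (Real.exp_pos _).le
    -- the real inequality behind the main piece (floors in `β₁, β₃, κz, σ` letters; `E ≤ 1` for the `Ktail` part)
    have hsplit : Real.exp (-(b / (14400 * (L : ℝ) ^ 6) * (2 * (1 + δt ^ 2)⁻¹ * ((x 1) ^ 2 + (x 2) ^ 2) / (1 + normSq3 x)))) *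
            Real.exp (-(b / (28800 * (L : ℝ) ^ 6) * normSq3 z)) *
            Real.exp (-(b / (3600 * (L : ℝ) ^ 6) * (4 * ((x 1 * y 2 - x 2 * y 1) ^ 2 + (x 2 * y 0 - x 0 * y 2) ^ 2 + (x 0 * y 1 - x 1 * y 0) ^ 2) /
              ((1 + normSq3 x) * (1 + normSq3 y))))) *
            (Real.exp (3 / 2) * Gb / Real.sqrt (LinearMap.det (A0 (gnoBase (Real.sqrt (normSq3 x)) ((Real.sqrt (normSq3 x))⁻¹ * (x 0 * y 0 + x 1 * y 1 + x 2 * y 2))))) +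
              Ktail) ≤ e1 * e3 * Dr * ((Real.exp (3 / 2) * Gb) * ez) + Ktail := by
      have hE1 : Real.exp (-(b / (14400 * (L : ℝ) ^ 6) * (2 * (1 + δt ^ 2)⁻¹ * ((x 1) ^ 2 + (x 2) ^ 2) / (1 + normSq3 x)))) = e1 := by rw [he1, hβ₁, hσ]
      have hE2 : Real.exp (-(b / (28800 * (L : ℝ) ^ 6) * normSq3 z)) = ez := by rw [hez, hκz]
      have hE3 : Real.exp (-(b / (3600 * (L : ℝ) ^ 6) * (4 * ((x 1 * y 2 - x 2 * y 1) ^ 2 + (x 2 * y 0 - x 0 * y 2) ^ 2 + (x 0 * y 1 - x 1 * y 0) ^ 2) /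
          ((1 + normSq3 x) * (1 + normSq3 y))))) = e3 := by rw [he3, hβ₃]
      rw [hE1, hE2, hE3, div_eq_mul_inv (Real.exp (3 / 2) * Gb), ← hDr, mul_add]
      refine add_le_add (le_of_eq (by ring)) ?_
      have h1 : e1 ≤ 1 := by
        rw [he1, Real.exp_le_one_iff, neg_nonpos]; exact mul_nonneg hβ₁0.le (div_nonneg (by positivity) (by linarith [normSq3_nonneg x]))
      have h2 : ez ≤ 1 := by rw [hez, Real.exp_le_one_iff, neg_nonpos]; exact mul_nonneg hκz0.le (normSq3_nonneg z)
      have h3 : e3 ≤ 1 := by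
        rw [he3, Real.exp_le_one_iff, neg_nonpos]
        exact mul_nonneg hβ₃0.le (div_nonneg (by positivity) (mul_nonneg (by linarith [normSq3_nonneg x]) (by linarith [normSq3_nonneg y])))
      have h123 : e1 * ez * e3 ≤ 1 := mul_le_one₀ (mul_le_one₀ h1 hez0 h2) he30 h3
      exact mul_le_of_le_one_left hKtail0 h123
    -- the main piece in `ℝ≥0∞`
    have hmainENN : ENNReal.ofReal (gnomonicWeight x * gnomonicWeight y * gnomonicWeight z) *
        ENNReal.ofReal (Real.exp (-(b / (14400 * (L : ℝ) ^ 6) * (2 * (1 + δt ^ 2)⁻¹ * ((x 1) ^ 2 + (x 2) ^ 2) / (1 + normSq3 x)))) *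
            Real.exp (-(b / (28800 * (L : ℝ) ^ 6) * normSq3 z)) *
            Real.exp (-(b / (3600 * (L : ℝ) ^ 6) * (4 * ((x 1 * y 2 - x 2 * y 1) ^ 2 + (x 2 * y 0 - x 0 * y 2) ^ 2 + (x 0 * y 1 - x 1 * y 0) ^ 2) /
              ((1 + normSq3 x) * (1 + normSq3 y))))) *
            (Real.exp (3 / 2) * Gb / Real.sqrt (LinearMap.det (A0 (gnoBase (Real.sqrt (normSq3 x)) ((Real.sqrt (normSq3 x))⁻¹ * (x 0 * y 0 + x 1 * y 1 + x 2 * y 2))))) +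
              Ktail)) ≤
        ENNReal.ofReal (gnomonicWeight x * e1) * (ENNReal.ofReal (gnomonicWeight y * e3) * ENNReal.ofReal Dr) *
            (ENNReal.ofReal (Real.exp (3 / 2) * Gb) * ENNReal.ofReal (gnomonicWeight z * ez)) +
          ENNReal.ofReal (gnomonicWeight x * gnomonicWeight y) * (ENNReal.ofReal (gnomonicWeight z) * ENNReal.ofReal Ktail) := by
      refine (mul_le_mul' le_rfl (ENNReal.ofReal_le_ofReal hsplit)).trans (le_of_eq ?_)
      have hA : 0 ≤ gnomonicWeight x * e1 * (gnomonicWeight y * e3 * Dr) := by positivity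
      have hB : 0 ≤ Real.exp (3 / 2) * Gb * (gnomonicWeight z * ez) := by positivity
      have hC : 0 ≤ gnomonicWeight x * gnomonicWeight y * (gnomonicWeight z * Ktail) := by positivity
      rw [← ENNReal.ofReal_mul hw3,
        show gnomonicWeight x * gnomonicWeight y * gnomonicWeight z * (e1 * e3 * Dr * (Real.exp (3 / 2) * Gb * ez) + Ktail) =
          gnomonicWeight x * e1 * (gnomonicWeight y * e3 * Dr) * (Real.exp (3 / 2) * Gb * (gnomonicWeight z * ez)) +
            gnomonicWeight x * gnomonicWeight y * (gnomonicWeight z * Ktail) by ring,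
        ENNReal.ofReal_add (mul_nonneg hA hB) hC, ENNReal.ofReal_mul hA, ENNReal.ofReal_mul (mul_nonneg hwx he10),
        ENNReal.ofReal_mul (mul_nonneg hwy he30), ENNReal.ofReal_mul (by positivity : 0 ≤ Real.exp (3 / 2) * Gb),
        ENNReal.ofReal_mul (mul_nonneg hwx hwy), ENNReal.ofReal_mul' hKtail0]
    have hfarENN : ENNReal.ofReal (gnomonicWeight x * gnomonicWeight y * gnomonicWeight z) * Tfar =
        ENNReal.ofReal (gnomonicWeight x * gnomonicWeight y) * (ENNReal.ofReal (gnomonicWeight z) * Tfar) := by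
      rw [ENNReal.ofReal_mul (mul_nonneg hwx hwy), mul_assoc]
    rw [hEx, hFy, hEz, hDm]
    simp only
    rw [← he1, ← he3, ← hez, ← hDr]
    calc _ ≤ (ENNReal.ofReal (gnomonicWeight x * e1) * (ENNReal.ofReal (gnomonicWeight y * e3) * ENNReal.ofReal Dr) *
            (ENNReal.ofReal (Real.exp (3 / 2) * Gb) * ENNReal.ofReal (gnomonicWeight z * ez)) +
          ENNReal.ofReal (gnomonicWeight x * gnomonicWeight y) * (ENNReal.ofReal (gnomonicWeight z) * ENNReal.ofReal Ktail)) +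
          ENNReal.ofReal (gnomonicWeight x * gnomonicWeight y) * (ENNReal.ofReal (gnomonicWeight z) * Tfar) := add_le_add hmainENN hfarENN.le
      _ = _ := by ring
  -- INTEGRATION
  set cG : ℝ := Real.exp (3 / 2) * Gb with hcG
  set cA : ℝ := cG * (Real.pi / κz) ^ ((3 : ℝ) / 2) with hcA
  have hcA0 : 0 ≤ cA := by positivity
  set kt : ℝ := Ktail + Real.exp (-(b * rate)) * Real.exp (60 * (L : ℝ) ^ 4) with hkt
  have hkt0 : 0 ≤ kt := by positivity
  have hTfar : Tfar ≤ ENNReal.ofReal (Real.exp (-(b * rate)) * Real.exp (60 * (L : ℝ) ^ 4)) := by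
    rw [hTfar, ENNReal.ofReal_mul (Real.exp_pos _).le]
    exact mul_le_mul' le_rfl lintegral_piWeight_le_exp
  have hKT : ENNReal.ofReal Ktail + Tfar ≤ ENNReal.ofReal kt := by
    rw [hkt, ENNReal.ofReal_add hKtail0 (by positivity)]; exact add_le_add le_rfl hTfar
  set Wxy : (Fin 3 → ℝ) × (Fin 3 → ℝ) → ℝ≥0∞ := fun xy => ENNReal.ofReal (gnomonicWeight xy.1 * gnomonicWeight xy.2) with hWxy
  have hWxym : Measurable Wxy := by rw [hWxy]; exact Measurable.ennreal_ofReal ((hw.comp measurable_fst).mul (hw.comp measurable_snd))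
  -- the inner `z`-integral, per `xy ∈ S`
  have hinner : ∀ xy ∈ S,
      ∫⁻ z : Fin 3 → ℝ, ENNReal.ofReal (gnomonicWeight xy.1 * gnomonicWeight xy.2 * gnomonicWeight z) *
          ∫⁻ F : Fol L → Fin 3 → ℝ, ENNReal.ofReal (Real.exp (-(b * gnoDeficit (fun _ => false) (fun _ => 1) (hubAt δt 1) ε ((xy, (z, F)) : GnoCoord L))) * piWeight F) ≤
        Ex xy.1 * Fy xy.1 xy.2 * ENNReal.ofReal cA + Wxy xy * ENNReal.ofReal (Real.pi ^ 2 * kt) := by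
    intro xy hxy
    have hg : Measurable fun z : Fin 3 → ℝ => Wxy xy * (ENNReal.ofReal Ktail + Tfar) * ENNReal.ofReal (gnomonicWeight z) :=
      measurable_const.mul (Measurable.ennreal_ofReal hw)
    have hm1 : Measurable fun z : Fin 3 → ℝ => ENNReal.ofReal cG * Ez z := measurable_const.mul hEzm
    have hm0 : Measurable fun z : Fin 3 → ℝ => ENNReal.ofReal (gnomonicWeight z) := Measurable.ennreal_ofReal hw
    calc _ ≤ ∫⁻ z : Fin 3 → ℝ, (Ex xy.1 * Fy xy.1 xy.2 * (ENNReal.ofReal cG * Ez z) + Wxy xy * (ENNReal.ofReal Ktail + Tfar) * ENNReal.ofReal (gnomonicWeight z)) :=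
          lintegral_mono fun z => hpt xy hxy z
      _ = Ex xy.1 * Fy xy.1 xy.2 * (ENNReal.ofReal cG * ∫⁻ z, Ez z) + Wxy xy * (ENNReal.ofReal Ktail + Tfar) * ∫⁻ z : Fin 3 → ℝ, ENNReal.ofReal (gnomonicWeight z) := by
          rw [lintegral_add_right _ hg, lintegral_const_mul _ hm1, lintegral_const_mul _ hEzm, lintegral_const_mul _ hm0]
      _ ≤ Ex xy.1 * Fy xy.1 xy.2 * (ENNReal.ofReal cG * ENNReal.ofReal ((Real.pi / κz) ^ ((3 : ℝ) / 2))) + Wxy xy * ENNReal.ofReal kt * ENNReal.ofReal (Real.pi ^ 2) := by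
          rw [hWz]; exact add_le_add (mul_le_mul' le_rfl (mul_le_mul' le_rfl hZ)) (mul_le_mul' (mul_le_mul' le_rfl hKT) le_rfl)
      _ = Ex xy.1 * Fy xy.1 xy.2 * ENNReal.ofReal cA + Wxy xy * ENNReal.ofReal (Real.pi ^ 2 * kt) := by
          rw [hcA, ENNReal.ofReal_mul (by positivity : 0 ≤ cG), ENNReal.ofReal_mul (by positivity : 0 ≤ Real.pi ^ 2)]; ring
  -- the outer integral over `S`
  have hMAIN : ∫⁻ xy in S, Ex xy.1 * Fy xy.1 xy.2 ≤
      ENNReal.ofReal ((3 * Real.pi + 48) * Real.pi ^ 2 / (β₁ * β₃)) *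
        ∫⁻ p : ℝ × ℝ, ENNReal.ofReal ((1 + δt ^ 2) ^ 2 / (1 + (p.1 ^ 2 / (1 + p.1 ^ 2) + p.2 ^ 2 / (1 + p.2 ^ 2)) * (1 + δt ^ 2)) *
          ((1 + p.1 ^ 2)⁻¹ * (1 + p.2 ^ 2)⁻¹)) * Dm p :=
    lintegral_PX_main_le hδt1 hβ₁0 hβ₃0 hDmm
  have hWW : ∫⁻ xy in S, Wxy xy ≤ ENNReal.ofReal (Real.pi ^ 2) * ENNReal.ofReal (Real.pi ^ 2) := by
    calc ∫⁻ xy in S, Wxy xy ≤ ∫⁻ xy, Wxy xy := lintegral_mono' Measure.restrict_le_self le_rfl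
      _ = ∫⁻ xy : (Fin 3 → ℝ) × (Fin 3 → ℝ), ENNReal.ofReal (gnomonicWeight xy.1) * ENNReal.ofReal (gnomonicWeight xy.2) := by
          refine lintegral_congr fun xy => ?_; rw [hWxy]; exact ENNReal.ofReal_mul (gnomonicWeight_pos _).le
      _ = (∫⁻ x : Fin 3 → ℝ, ENNReal.ofReal (gnomonicWeight x)) * ∫⁻ y : Fin 3 → ℝ, ENNReal.ofReal (gnomonicWeight y) := by
          rw [show (volume : Measure ((Fin 3 → ℝ) × (Fin 3 → ℝ))) = (volume : Measure (Fin 3 → ℝ)).prod volume from rfl]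
          exact lintegral_prod_mul (Measurable.ennreal_ofReal hw).aemeasurable (Measurable.ennreal_ofReal hw).aemeasurable
      _ = ENNReal.ofReal (Real.pi ^ 2) * ENNReal.ofReal (Real.pi ^ 2) := by rw [hWz]
  have houter : ∫⁻ xy in S, ∫⁻ z : Fin 3 → ℝ, ENNReal.ofReal (gnomonicWeight xy.1 * gnomonicWeight xy.2 * gnomonicWeight z) *
          ∫⁻ F : Fol L → Fin 3 → ℝ, ENNReal.ofReal (Real.exp (-(b * gnoDeficit (fun _ => false) (fun _ => 1) (hubAt δt 1) ε ((xy, (z, F)) : GnoCoord L))) * piWeight F) ≤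
      (ENNReal.ofReal ((3 * Real.pi + 48) * Real.pi ^ 2 / (β₁ * β₃)) *
        ∫⁻ p : ℝ × ℝ, ENNReal.ofReal ((1 + δt ^ 2) ^ 2 / (1 + (p.1 ^ 2 / (1 + p.1 ^ 2) + p.2 ^ 2 / (1 + p.2 ^ 2)) * (1 + δt ^ 2)) *
          ((1 + p.1 ^ 2)⁻¹ * (1 + p.2 ^ 2)⁻¹)) * Dm p) * ENNReal.ofReal cA +
        ENNReal.ofReal (Real.pi ^ 2) * ENNReal.ofReal (Real.pi ^ 2) * ENNReal.ofReal (Real.pi ^ 2 * kt) := by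
    calc _ ≤ ∫⁻ xy in S, (Ex xy.1 * Fy xy.1 xy.2 * ENNReal.ofReal cA + Wxy xy * ENNReal.ofReal (Real.pi ^ 2 * kt)) := setLIntegral_mono' hS hinner
      _ = (∫⁻ xy in S, Ex xy.1 * Fy xy.1 xy.2) * ENNReal.ofReal cA + (∫⁻ xy in S, Wxy xy) * ENNReal.ofReal (Real.pi ^ 2 * kt) := by
          have hm2 : Measurable fun xy : (Fin 3 → ℝ) × (Fin 3 → ℝ) => Wxy xy * ENNReal.ofReal (Real.pi ^ 2 * kt) := hWxym.mul measurable_const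
          rw [lintegral_add_right _ hm2, lintegral_mul_const' _ _ ENNReal.ofReal_ne_top, lintegral_mul_const' _ _ ENNReal.ofReal_ne_top]
      _ ≤ _ := add_le_add (mul_le_mul' hMAIN le_rfl) (mul_le_mul' hWW le_rfl)
  -- constants
  refine houter.trans ?_
  have hP0 : ∀ p : ℝ × ℝ, 0 ≤ (1 + δt ^ 2) ^ 2 / (1 + (p.1 ^ 2 / (1 + p.1 ^ 2) + p.2 ^ 2 / (1 + p.2 ^ 2)) * (1 + δt ^ 2)) * ((1 + p.1 ^ 2)⁻¹ * (1 + p.2 ^ 2)⁻¹) :=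
    fun p => by positivity
  have hint : ∫⁻ p : ℝ × ℝ, ENNReal.ofReal ((1 + δt ^ 2) ^ 2 / (1 + (p.1 ^ 2 / (1 + p.1 ^ 2) + p.2 ^ 2 / (1 + p.2 ^ 2)) * (1 + δt ^ 2)) *
          ((1 + p.1 ^ 2)⁻¹ * (1 + p.2 ^ 2)⁻¹)) * Dm p =
      ∫⁻ p : ℝ × ℝ, ENNReal.ofReal ((1 + δt ^ 2) ^ 2 / (1 + (p.1 ^ 2 / (1 + p.1 ^ 2) + p.2 ^ 2 / (1 + p.2 ^ 2)) * (1 + δt ^ 2)) *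
          ((1 + p.1 ^ 2)⁻¹ * (1 + p.2 ^ 2)⁻¹ / Real.sqrt (LinearMap.det (A0 (gnoBase p.1 p.2))))) := by
    refine lintegral_congr fun p => ?_
    rw [hDm]; simp only
    rw [← ENNReal.ofReal_mul (hP0 p)]
    congr 1
    rw [div_eq_mul_inv ((1 + p.1 ^ 2)⁻¹ * (1 + p.2 ^ 2)⁻¹)]; ring
  -- main constant
  have hmainc : ENNReal.ofReal ((3 * Real.pi + 48) * Real.pi ^ 2 / (β₁ * β₃)) * ENNReal.ofReal cA ≤
      ENNReal.ofReal ((10 : ℝ) ^ 19 * (L : ℝ) ^ 24 * (2 * Real.pi / b) ^ ((7 : ℝ) / 2) * Gb) := by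
    rw [← ENNReal.ofReal_mul (by positivity)]
    refine ENNReal.ofReal_le_ofReal ?_
    have h := px_main_const_le (Lr := (L : ℝ)) hL1 hb0
    rw [hcA, hcG, hβ₁, hβ₃, hκz]
    calc (3 * Real.pi + 48) * Real.pi ^ 2 / (b / (14400 * (L : ℝ) ^ 6) * (b / (3600 * (L : ℝ) ^ 6))) *
          (Real.exp (3 / 2) * Gb * (Real.pi / (b / (28800 * (L : ℝ) ^ 6))) ^ ((3 : ℝ) / 2))
        = Gb * (Real.exp (3 / 2) * (Real.pi / (b / (28800 * (L : ℝ) ^ 6))) ^ ((3 : ℝ) / 2) *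
            ((3 * Real.pi + 48) * Real.pi ^ 2 / (b / (14400 * (L : ℝ) ^ 6) * (b / (3600 * (L : ℝ) ^ 6))))) := by ring
      _ ≤ Gb * ((10 : ℝ) ^ 19 * (L : ℝ) ^ 24 * (2 * Real.pi / b) ^ ((7 : ℝ) / 2)) := mul_le_mul_of_nonneg_left h hGb0
      _ = (10 : ℝ) ^ 19 * (L : ℝ) ^ 24 * (2 * Real.pi / b) ^ ((7 : ℝ) / 2) * Gb := by ring
  -- tail constant
  have htailc : ENNReal.ofReal (Real.pi ^ 2) * ENNReal.ofReal (Real.pi ^ 2) * ENNReal.ofReal (Real.pi ^ 2 * kt) ≤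
      ENNReal.ofReal (Real.exp (70 * (L : ℝ) ^ 88 - b / (QT * (L : ℝ) ^ 88))) := by
    rw [← ENNReal.ofReal_mul (by positivity), ← ENNReal.ofReal_mul (by positivity)]
    refine ENNReal.ofReal_le_ofReal ?_
    have hR1 : Real.exp (-(b * κR)) ≤ Real.exp (-(b / (QT * (L : ℝ) ^ 88))) := by
      refine Real.exp_le_exp.2 (neg_le_neg ?_)
      rw [div_eq_mul_inv]; exact mul_le_mul_of_nonneg_left (by rw [hκR, hQT]; exact hrate_R) hb0.le
    have hR2 : Real.exp (-(b * rate)) ≤ Real.exp (-(b / (QT * (L : ℝ) ^ 88))) := by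
      refine Real.exp_le_exp.2 (neg_le_neg ?_)
      rw [div_eq_mul_inv]; exact mul_le_mul_of_nonneg_left (by rw [hrate, hQT, hsT, hκf]; exact hrate_far) hb0.le
    have hkt_le : kt ≤ (Real.exp (60 * (L : ℝ) ^ 4) + Real.exp (60 * (L : ℝ) ^ 4)) * Real.exp (-(b / (QT * (L : ℝ) ^ 88))) := by
      rw [hkt, hKtail, add_mul]
      refine add_le_add ?_ ?_
      · rw [mul_comm]; exact mul_le_mul hIWle hR1 (Real.exp_pos _).le (Real.exp_pos _).le
      · rw [mul_comm]; exact mul_le_mul_of_nonneg_left hR2 (Real.exp_pos _).le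
    calc Real.pi ^ 2 * Real.pi ^ 2 * (Real.pi ^ 2 * kt) = Real.pi ^ 6 * kt := by ring
      _ ≤ Real.pi ^ 6 * ((Real.exp (60 * (L : ℝ) ^ 4) + Real.exp (60 * (L : ℝ) ^ 4)) * Real.exp (-(b / (QT * (L : ℝ) ^ 88)))) :=
          mul_le_mul_of_nonneg_left hkt_le (by positivity)
      _ = Real.pi ^ 6 * (Real.exp (60 * (L : ℝ) ^ 4) + Real.exp (60 * (L : ℝ) ^ 4)) * Real.exp (-(b / (QT * (L : ℝ) ^ 88))) := by ring
      _ ≤ Real.exp (70 * (L : ℝ) ^ 88 - b / (QT * (L : ℝ) ^ 88)) := px_tail_const_le hL1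
  calc (ENNReal.ofReal ((3 * Real.pi + 48) * Real.pi ^ 2 / (β₁ * β₃)) *
        ∫⁻ p : ℝ × ℝ, ENNReal.ofReal ((1 + δt ^ 2) ^ 2 / (1 + (p.1 ^ 2 / (1 + p.1 ^ 2) + p.2 ^ 2 / (1 + p.2 ^ 2)) * (1 + δt ^ 2)) *
          ((1 + p.1 ^ 2)⁻¹ * (1 + p.2 ^ 2)⁻¹)) * Dm p) * ENNReal.ofReal cA +
        ENNReal.ofReal (Real.pi ^ 2) * ENNReal.ofReal (Real.pi ^ 2) * ENNReal.ofReal (Real.pi ^ 2 * kt)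
      = ENNReal.ofReal ((3 * Real.pi + 48) * Real.pi ^ 2 / (β₁ * β₃)) * ENNReal.ofReal cA *
          (∫⁻ p : ℝ × ℝ, ENNReal.ofReal ((1 + δt ^ 2) ^ 2 / (1 + (p.1 ^ 2 / (1 + p.1 ^ 2) + p.2 ^ 2 / (1 + p.2 ^ 2)) * (1 + δt ^ 2)) *
            ((1 + p.1 ^ 2)⁻¹ * (1 + p.2 ^ 2)⁻¹ / Real.sqrt (LinearMap.det (A0 (gnoBase p.1 p.2)))))) +
        ENNReal.ofReal (Real.pi ^ 2) * ENNReal.ofReal (Real.pi ^ 2) * ENNReal.ofReal (Real.pi ^ 2 * kt) := by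
        rw [hint]; ring
    _ ≤ _ := add_le_add (mul_le_mul' hmainc le_rfl) htailc

end Summit.QuantumFields.YangMills.Theorems.SwapVirialDeficit.SectorLaplace

end
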